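import Summits.ResolutionOfSingularities.ResolutionOfSingularities.Theorems.EquisingularLiftEquisingularLiftNatDeltaConeLift
import Mathlib
import HarnessLib

/-!
# [OURS · L1 W4.5(b)] T-ΔLIFT for PLANE traces (`r = 3`): the finiteness hypothesis from square-freeness of the
# dehomogenised trace (crux `EquisingularLiftNat` = stmt-ResolutionOfSingularities-20038, stub `stub_elnat_tcDeltaPointResolution`)

NOT a statement of any manuscript. Helper file of the chain res-L1-w45b (cell `res-hironaka`, rung L, slot
W4.5(b)); AI-written, weaker than expert review; filed `--supports stmt-ResolutionOfSingularities-20038 --as helper`.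
Continuation of `…Theorems.EquisingularLiftEquisingularLiftNatDeltaConeLift` (T-ΔLIFT, p516044).

T-ΔLIFT (`exists_isHomogeneous_lift_deltaRegular`) asks, chart by chart, that the primes `𝔮 ∋ g(Tᵢ := 1)` of
`k[T_j : j ≠ i]` with `g(Tᵢ := 1) ∈ 𝔪_𝔮²` be finitely many. For the carrier of a POINT of a threefold (`r = 3`, the
trace a plane curve in `e ≅ ℙ²_k`) and a REDUCED trace this is automatic: a non-zero square-free polynomial in two
variables has finitely many such primes (`finite_setOf_mem_sq`, p501885 — the non-regular locus of a reduced plane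
curve). This file transports that fact from `MvPolynomial (Fin 2) k` to the chart rings `MvPolynomial {j : Fin 3 // j ≠ i} k`
and packages the plane form of T-ΔLIFT:
* `squarefree_map_of_mulEquiv` — square-freeness moves along a multiplicative equivalence;
* `finite_setOf_mem_sq_of_ringEquiv` — the finite «bad set» `{𝔮 | a ∈ 𝔮 ∧ a ∈ 𝔪_𝔮²}` moves along a ring isomorphism;
* `finite_setOf_mem_sq_chart` — for `i : Fin 3` and `0 ≠ f ∈ k[T_j : j ≠ i]` square-free, the bad set of `f` is finite;
* **`exists_isHomogeneous_lift_deltaRegular_plane`** — `O` a DVR, `ϖ` irreducible, `π : O ↠ k` onto an infinite field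
  with `ker π = (ϖ)` (or `= 𝔪_O`, primed form), `g ∈ k[T₀, T₁, T₂]` a NON-ZERO form of degree `d` whose three
  dehomogenisations are SQUARE-FREE (the trace `V(g) ⊂ ℙ²_k` is reduced) ⟹ there is a form `Φ ∈ O[T₀, T₁, T₂]` of
  degree `d` with `π Φ = g` all of whose dehomogenised Δ-curve rings `O[T_j : j ≠ i] ⧸ (Φ(Tᵢ := 1))` are regular local
  rings at every prime containing `ϖ`.

References: H. Matsumura, *Commutative Ring Theory* (1986), Thm. 14.2 (index only).
-/

set_option linter.dupNamespace false -- mandated namespace `Summit.<Summit>.<Problem>` of this single-conjunct summit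
set_option linter.overlappingInstances false -- signatures carry both [IsDomain O] and [IsDiscreteValuationRing O] (Mathlib's class takes the former as a parameter)

noncomputable section

namespace Summit.ResolutionOfSingularities.ResolutionOfSingularities.Cruxes.EquisingularLiftNat.Sections

open MvPolynomial IsLocalRing Literature.AlgebraicGeometry.Resolution
open Summit.ResolutionOfSingularities.ResolutionOfSingularities.Theorems

universe u

/-! ## Transport of square-freeness and of the bad set along isomorphisms -/

section Transport

/-- Square-freeness moves along a multiplicative equivalence. [folklore] -/
theorem squarefree_map_of_mulEquiv {A B : Type*} [Monoid A] [Monoid B] (e : A ≃* B) {x : A} (hx : Squarefree x) :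
    Squarefree (e x) := by
  intro y hy
  have h1 : e.symm y * e.symm y ∣ x := by
    have := map_dvd e.symm hy
    rwa [map_mul, e.symm_apply_apply] at this
  have h2 : IsUnit (e.symm y) := hx _ h1
  have h3 := h2.map e
  rwa [e.apply_symm_apply] at h3

/-- **The bad set moves along a ring isomorphism.** For `E : A ≃+* B` and `a ∈ A`: if the primes `𝔮' ∋ E a` of `B`
with `E a ∈ 𝔪_{𝔮'}²` are finitely many, so are the primes `𝔮 ∋ a` of `A` with `a ∈ 𝔪_𝔮²` (`𝔮 ↦ E(𝔮)` is injective and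
respects both conditions, `notMem_sq_of_map_notMem_sq` p501885). [folklore] [OURS · L1 W4.5b] -/
theorem finite_setOf_mem_sq_of_ringEquiv {A B : Type u} [CommRing A] [CommRing B] (E : A ≃+* B) (a : A)
    (hB : {𝔮 : PrimeSpectrum B | E a ∈ 𝔮.asIdeal ∧
      algebraMap B (Localization.AtPrime 𝔮.asIdeal) (E a) ∈ maximalIdeal (Localization.AtPrime 𝔮.asIdeal) ^ 2}.Finite) :
    {𝔮 : PrimeSpectrum A | a ∈ 𝔮.asIdeal ∧
      algebraMap A (Localization.AtPrime 𝔮.asIdeal) a ∈ maximalIdeal (Localization.AtPrime 𝔮.asIdeal) ^ 2}.Finite := by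
  -- `φ : Spec A → Spec B`, `𝔮 ↦ (E.symm)⁻¹ 𝔮 = E(𝔮)`
  let φ : PrimeSpectrum A → PrimeSpectrum B := PrimeSpectrum.comap (E.symm : B →+* A)
  have hφinj : Function.Injective φ := by
    intro 𝔮₁ 𝔮₂ h
    have h' : (φ 𝔮₁).asIdeal.comap (E : A →+* B) = (φ 𝔮₂).asIdeal.comap (E : A →+* B) := by rw [h]
    have hback : ∀ 𝔮 : PrimeSpectrum A, (φ 𝔮).asIdeal.comap (E : A →+* B) = 𝔮.asIdeal := fun 𝔮 => by
      ext x
      simp only [φ, PrimeSpectrum.comap_asIdeal, Ideal.mem_comap, RingHom.coe_coe, RingEquiv.symm_apply_apply]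
    rw [hback, hback] at h'
    exact PrimeSpectrum.ext h'
  refine (hB.preimage hφinj.injOn).subset ?_
  rintro 𝔮 ⟨ha, ha2⟩
  have hcomap : 𝔮.asIdeal = (φ 𝔮).asIdeal.comap (E : A →+* B) := by
    ext x
    simp only [φ, PrimeSpectrum.comap_asIdeal, Ideal.mem_comap, RingHom.coe_coe, RingEquiv.symm_apply_apply]
  refine ⟨?_, ?_⟩
  · have : a ∈ (φ 𝔮).asIdeal.comap (E : A →+* B) := hcomap ▸ ha
    exact this
  · by_contra hnot
    exact (notMem_sq_of_map_notMem_sq (E : A →+* B) (φ 𝔮).asIdeal 𝔮.asIdeal hcomap hnot) ha2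

end Transport

/-! ## The bad set of a square-free polynomial on a chart of `ℙ²` is finite -/

section Chart

variable {k : Type} [Field k]

/-- A chart of `ℙ²` has two coordinates. [folklore] -/
theorem card_ne_fin_three (i : Fin 3) : Fintype.card {j : Fin 3 // j ≠ i} = 2 := by
  fin_cases i <;> rfl

/-- **Finiteness of the bad set on a chart of `ℙ²`.** For `i : Fin 3` and a non-zero SQUARE-FREE
`f ∈ k[T_j : j ≠ i]` (a reduced affine plane curve), the primes `𝔮 ∋ f` with `f ∈ 𝔪_𝔮²` — the non-regular points of
`V(f)` — are finitely many (`finite_setOf_mem_sq`, p501885, transported along `k[T_j : j ≠ i] ≅ k[x, y]`).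
[folklore] [OURS · L1 W4.5b] -/
theorem finite_setOf_mem_sq_chart (i : Fin 3) {f : MvPolynomial {j : Fin 3 // j ≠ i} k} (hf0 : f ≠ 0)
    (hsq : Squarefree f) :
    {𝔮 : PrimeSpectrum (MvPolynomial {j : Fin 3 // j ≠ i} k) | f ∈ 𝔮.asIdeal ∧
      algebraMap (MvPolynomial {j : Fin 3 // j ≠ i} k) (Localization.AtPrime 𝔮.asIdeal) f ∈
        maximalIdeal (Localization.AtPrime 𝔮.asIdeal) ^ 2}.Finite := by
  -- the renaming `k[T_j : j ≠ i] ≅ k[x, y]`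
  let e : {j : Fin 3 // j ≠ i} ≃ Fin 2 := Fintype.equivFinOfCardEq (card_ne_fin_three i)
  let E : MvPolynomial {j : Fin 3 // j ≠ i} k ≃+* MvPolynomial (Fin 2) k := (renameEquiv k e).toRingEquiv
  have hE : ∀ p, E p = rename e p := fun p => rfl
  have hf0' : E f ≠ 0 := by
    rw [hE, Ne, rename_eq_zero_iff_of_injective _ e.injective]
    exact hf0
  have hsq' : Squarefree (E f) := squarefree_map_of_mulEquiv E.toMulEquiv hsq
  exact finite_setOf_mem_sq_of_ringEquiv E f (finite_setOf_mem_sq hf0' hsq')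

end Chart

/-! ## T-ΔLIFT for plane traces -/

section Plane

variable {O : Type} [CommRing O] [IsDomain O] [IsDiscreteValuationRing O] {ϖ : O}
variable {k : Type} [Field k] [Infinite k]

/-- **T-ΔLIFT for a reduced plane trace.** `O` a DVR with uniformizer `ϖ`, `π : O ↠ k` onto an infinite field with
`ker π = (ϖ)`, `g ∈ k[T₀, T₁, T₂]` a non-zero form of degree `d` whose three dehomogenisations `g(Tᵢ := 1)` are
square-free (the trace `V(g) ⊂ ℙ²_k` is REDUCED). Then there is a form `Φ ∈ O[T₀, T₁, T₂]` of degree `d` with `π Φ = g`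
such that for every chart `i` the Δ-curve ring `O[T_j : j ≠ i] ⧸ (Φ(Tᵢ := 1))` is a regular local ring at every prime
containing `ϖ` (`exists_isHomogeneous_lift_deltaRegular`, p516044, with `finite_setOf_mem_sq_chart`).
[cite: Matsumura1987, Thm. 14.2] [OURS · L1 W4.5b] -/
theorem exists_isHomogeneous_lift_deltaRegular_plane (hϖ : Irreducible ϖ) (π : O →+* k)
    (hπ : Function.Surjective π) (hker : RingHom.ker π = Ideal.span {ϖ}) {d : ℕ} (g : MvPolynomial (Fin 3) k)
    (hg : g.IsHomogeneous d) (hg0 : g ≠ 0) (hsq : ∀ i : Fin 3, Squarefree (dehomogenize i g)) :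
    ∃ Φ : MvPolynomial (Fin 3) O, Φ.IsHomogeneous d ∧ MvPolynomial.map π Φ = g ∧
      ∀ (i : Fin 3) (Q : Ideal (MvPolynomial {j : Fin 3 // j ≠ i} O ⧸ Ideal.span {dehomogenize i Φ})) [Q.IsPrime],
        Ideal.Quotient.mk (Ideal.span {dehomogenize i Φ}) (C ϖ : MvPolynomial {j : Fin 3 // j ≠ i} O) ∈ Q →
          IsRegularLocalRing (Localization.AtPrime Q) :=
  exists_isHomogeneous_lift_deltaRegular hϖ π hπ hker g hg fun i =>
    finite_setOf_mem_sq_chart i (dehomogenize_ne_zero_of_isHomogeneous i hg hg0) (hsq i)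

/-- **T-ΔLIFT for a reduced plane trace, `ker π = 𝔪_O` spelling** (K4 / T-INST currency). [cite: Matsumura1987, Thm. 14.2]
[OURS · L1 W4.5b] -/
theorem exists_isHomogeneous_lift_deltaRegular_plane' (hϖ : Irreducible ϖ) (π : O →+* k)
    (hπ : Function.Surjective π) (hker : RingHom.ker π = maximalIdeal O) {d : ℕ} (g : MvPolynomial (Fin 3) k)
    (hg : g.IsHomogeneous d) (hg0 : g ≠ 0) (hsq : ∀ i : Fin 3, Squarefree (dehomogenize i g)) :
    ∃ Φ : MvPolynomial (Fin 3) O, Φ.IsHomogeneous d ∧ MvPolynomial.map π Φ = g ∧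
      ∀ (i : Fin 3) (Q : Ideal (MvPolynomial {j : Fin 3 // j ≠ i} O ⧸ Ideal.span {dehomogenize i Φ})) [Q.IsPrime],
        Ideal.Quotient.mk (Ideal.span {dehomogenize i Φ}) (C ϖ : MvPolynomial {j : Fin 3 // j ≠ i} O) ∈ Q →
          IsRegularLocalRing (Localization.AtPrime Q) :=
  exists_isHomogeneous_lift_deltaRegular_plane hϖ π hπ (hker.trans hϖ.maximalIdeal_eq) g hg hg0 hsq

/-- **T-ΔLIFT for a reduced plane trace, radical-ideal spelling** (res-type-097 T-TCONE part 3 (R2):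
`(span {ḡ(T_j := 1)}).IsRadical`; Mathlib `isRadical_iff_span_singleton` + `IsRadical.squarefree`).
[cite: Matsumura1987, Thm. 14.2] [OURS · L1 W4.5b] -/
theorem exists_isHomogeneous_lift_deltaRegular_plane_of_isRadical (hϖ : Irreducible ϖ) (π : O →+* k)
    (hπ : Function.Surjective π) (hker : RingHom.ker π = maximalIdeal O) {d : ℕ} (g : MvPolynomial (Fin 3) k)
    (hg : g.IsHomogeneous d) (hg0 : g ≠ 0)
    (hrad : ∀ i : Fin 3, (Ideal.span {dehomogenize i g} : Ideal (MvPolynomial {j : Fin 3 // j ≠ i} k)).IsRadical) :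
    ∃ Φ : MvPolynomial (Fin 3) O, Φ.IsHomogeneous d ∧ MvPolynomial.map π Φ = g ∧
      ∀ (i : Fin 3) (Q : Ideal (MvPolynomial {j : Fin 3 // j ≠ i} O ⧸ Ideal.span {dehomogenize i Φ})) [Q.IsPrime],
        Ideal.Quotient.mk (Ideal.span {dehomogenize i Φ}) (C ϖ : MvPolynomial {j : Fin 3 // j ≠ i} O) ∈ Q →
          IsRegularLocalRing (Localization.AtPrime Q) :=
  exists_isHomogeneous_lift_deltaRegular_plane' hϖ π hπ hker g hg hg0 fun i =>
    ((isRadical_iff_span_singleton).mpr (hrad i)).squarefree (dehomogenize_ne_zero_of_isHomogeneous i hg hg0)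

/-! ### The same conclusions read through a frame `O →ι R →ρ O` (`ρ ∘ ι = id`): the spelling of F3b's `hreg` binder
with `Λ := O`, `ρ := θ ∘ mk`, `Φ_R := ι_* Φ` (res-type-100 F4 rev 3: `θ ∘ mk ∘ ι = id`, `θ ϖ̄_R = ϖ`) -/

omit [IsDomain O] [IsDiscreteValuationRing O] [Infinite k] in
/-- Reading a chart equation through a frame `ρ ∘ ι = id` changes nothing:
`ρ_* ((ι_* Φ)(Tᵢ := 1)) = Φ(Tᵢ := 1)`. [folklore] -/
theorem map_dehomogenize_map_of_comp_eq_id {R : Type} [CommRing R] (ι : O →+* R) (ρ : R →+* O)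
    (hρι : ρ.comp ι = RingHom.id O) {r : ℕ} (i : Fin r) (Φ : MvPolynomial (Fin r) O) :
    MvPolynomial.map ρ (dehomogenize i (MvPolynomial.map ι Φ)) = dehomogenize i Φ := by
  rw [map_dehomogenize, MvPolynomial.map_map, hρι, MvPolynomial.map_id]

/-- **T-ΔLIFT through a frame** (general `r`, finiteness hypothesis as in `exists_isHomogeneous_lift_deltaRegular`):
the Δ-regularity conclusion spelled for the chart equations `ρ_* ((ι_* Φ)(Tᵢ := 1))`, `ρ ∘ ι = id` — the literal
shape of the `hreg` binder of res-type-100's `isRegular_carrierDelta_subscheme` (p513634) with `Λ := O`,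
`ρ := θ ∘ mk`, after `θ ϖ̄_R = ϖ` (F4). [cite: Matsumura1987, Thm. 14.2] [OURS · L1 W4.5b] -/
theorem exists_isHomogeneous_lift_deltaRegular_comp (hϖ : Irreducible ϖ) (π : O →+* k)
    (hπ : Function.Surjective π) (hker : RingHom.ker π = maximalIdeal O)
    {R : Type} [CommRing R] (ι : O →+* R) (ρ : R →+* O) (hρι : ρ.comp ι = RingHom.id O)
    {r d : ℕ} (g : MvPolynomial (Fin r) k) (hg : g.IsHomogeneous d)
    (hfin : ∀ i : Fin r, {𝔮 : PrimeSpectrum (MvPolynomial {j : Fin r // j ≠ i} k) |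
      dehomogenize i g ∈ 𝔮.asIdeal ∧
      algebraMap (MvPolynomial {j : Fin r // j ≠ i} k) (Localization.AtPrime 𝔮.asIdeal) (dehomogenize i g) ∈
        maximalIdeal (Localization.AtPrime 𝔮.asIdeal) ^ 2}.Finite) :
    ∃ Φ : MvPolynomial (Fin r) O, Φ.IsHomogeneous d ∧ MvPolynomial.map π Φ = g ∧
      ∀ (i : Fin r) (Q : Ideal (MvPolynomial {j : Fin r // j ≠ i} O ⧸
          Ideal.span {MvPolynomial.map ρ (dehomogenize i (MvPolynomial.map ι Φ))})) [Q.IsPrime],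
        Ideal.Quotient.mk (Ideal.span {MvPolynomial.map ρ (dehomogenize i (MvPolynomial.map ι Φ))})
            (C ϖ : MvPolynomial {j : Fin r // j ≠ i} O) ∈ Q →
          IsRegularLocalRing (Localization.AtPrime Q) := by
  obtain ⟨Φ, hΦ, hΦg, hreg⟩ := exists_isHomogeneous_lift_deltaRegular' hϖ π hπ hker g hg hfin
  refine ⟨Φ, hΦ, hΦg, fun i => ?_⟩
  rw [map_dehomogenize_map_of_comp_eq_id ι ρ hρι i Φ]
  exact hreg i

/-- **T-ΔLIFT PLANE through a frame** (`r = 3`, reduced trace): as `exists_isHomogeneous_lift_deltaRegular_plane'`,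
conclusion spelled for `ρ_* ((ι_* Φ)(Tᵢ := 1))` with `ρ ∘ ι = id`. [cite: Matsumura1987, Thm. 14.2] [OURS · L1 W4.5b] -/
theorem exists_isHomogeneous_lift_deltaRegular_plane_comp (hϖ : Irreducible ϖ) (π : O →+* k)
    (hπ : Function.Surjective π) (hker : RingHom.ker π = maximalIdeal O)
    {R : Type} [CommRing R] (ι : O →+* R) (ρ : R →+* O) (hρι : ρ.comp ι = RingHom.id O)
    {d : ℕ} (g : MvPolynomial (Fin 3) k) (hg : g.IsHomogeneous d) (hg0 : g ≠ 0)
    (hsq : ∀ i : Fin 3, Squarefree (dehomogenize i g)) :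
    ∃ Φ : MvPolynomial (Fin 3) O, Φ.IsHomogeneous d ∧ MvPolynomial.map π Φ = g ∧
      ∀ (i : Fin 3) (Q : Ideal (MvPolynomial {j : Fin 3 // j ≠ i} O ⧸
          Ideal.span {MvPolynomial.map ρ (dehomogenize i (MvPolynomial.map ι Φ))})) [Q.IsPrime],
        Ideal.Quotient.mk (Ideal.span {MvPolynomial.map ρ (dehomogenize i (MvPolynomial.map ι Φ))})
            (C ϖ : MvPolynomial {j : Fin 3 // j ≠ i} O) ∈ Q →
          IsRegularLocalRing (Localization.AtPrime Q) :=
  exists_isHomogeneous_lift_deltaRegular_comp hϖ π hπ hker ι ρ hρι g hg fun i =>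
    finite_setOf_mem_sq_chart i (dehomogenize_ne_zero_of_isHomogeneous i hg hg0) (hsq i)

end Plane

end Summit.ResolutionOfSingularities.ResolutionOfSingularities.Cruxes.EquisingularLiftNat.Sections

end
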